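/-
  stub-ideation k = 2 (g41) · technique «literature transfer (recent-theorem-open-question harvest; typed
  dictionary)» · crux `SplitBadTwoLowerHalfOfFacts` (stmt-BirchSwinnertonDyer-27851) · stub
  `stub_heegnerIndexLowerAtTwo` (skeleton f2bd84c029a8a938, LEAD cf2-p1 g8 v3).

  NOTHING HERE PROVES BSD, THE CRUX, OR THE STUB.  What this file proves: the CONTEXT-FREE leaves of road B′'s
  residual R219-INST₂ «READ₂ instantiated» (STUB-PLAN v7.4 §HARDEST; CRITIC-ROWS-g41 rows 116–118 + k3-g41) are
  library lemmas in disguise and are closed here in kernel by a typed dictionary onto Mathlib / tree declarations,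
  so that R219-INST₂'s residue is purely witness-specific instantiation glue (the `∘ϑ` line, `V = L_b + const`,
  SEAM on units, one `read₂_of_refl_cut`):

  §C  «γ₀-CHARACTER» (B72 character half, ALL n ≥ 1; the critic `decide`d N = 4, 8): a character mod 2^{n+1}
      not factoring through 2^n is −1 at γ₀ = 1 + 2^n  [`apply_one_add_two_pow_eq_neg_one`;
      kernel of (ℤ/2^{n+1})ˣ → (ℤ/2^n)ˣ = {1, γ₀}: `mem_ker_unitsMap_iff`].
  §D  «H3 Λ₂-LIFT» (k3-g40 P3, hypothesis objects `hL0`/`hL` of its `read_value_eq_tsum_lamTerm`): the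
      coefficients (−1)^d 2^d/(d+1) of Λ₂ = ½ log(1+2X) are INTEGRAL in any ultrametric field with ‖2‖ < 1
      [`norm_two_pow_div_le_one`], hence `∃ L ∈ 𝒪_{ℂ_F}⟦X⟧` [`exists_Lam2_lift`, `exists_Lam2_lift_map`,
      `map_coeff_Lam2C`]; dictionary: Koblitz GTM 58 IV.1 / Washington GTM 83 §5.1 "p^d/(d+1) ∈ ℤ_p".
  §E  «H1 HALF-LIFT» (k3-g40 P3): P ≡ 1 (mod a) coefficientwise, P(0) = 1 ⇒ P = 1 + C a · y, y(0) = 0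
      [`exists_eq_one_add_C_mul`].
  §B  R222 «SHIFT₂» in the `evS` currency of R219-INST₂ — a 3-line corollary of the TREE theorem
      `coe_evalPt₁_compSeriesC_reflect` (located independently by k3-g41, who has priority for the location and
      the additive index identities); here: `evS_compSeriesC_shift(_negTwo)` + the multiplicative index identity
      `ζ^{j(1+2^n)} − 1 = −2 − (ζ^j − 1)` (j odd).
  §A  APPENDIX, NOT CLAIMED (k3-g41 filed `LocalUntwistExists` = R217∃ first, 22:09Z): an independent 45-line
      proof of the same verbatim statement straight from ★★ `exists_absGal_fixing_smul_ltRoot_eq` — kept only as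
      a port-size cross-check (k3-g41's U1/U2/U3 cut is the version of record).
  §F  degenerate-instance checks (B68).
-/
import Literature.NumberTheory.GaloisRepresentations.LubinTateColemanRelativeInterpolationTwo
import Literature.NumberTheory.GaloisRepresentations.LubinTateColemanRelativeAnomalyTwo
import Literature.NumberTheory.GaloisRepresentations.LubinTateComparisonReflectionTwo
import Mathlib.RingTheory.RootsOfUnity.PrimitiveRoots
import Mathlib.NumberTheory.DirichletCharacter.Basic
import Mathlib.Data.Nat.Factorization.Basic
import Mathlib.Analysis.Normed.Ring.Ultra
import HarnessLib

noncomputable section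

set_option linter.dupNamespace false

namespace Summit.BirchSwinnertonDyer.BirchSwinnertonDyer.Cruxes.SplitBadTwoLowerHalfOfFacts.DisjointShiftK2G41

/-! ## §A (APPENDIX, not claimed — k3-g41 has priority). R217∃ «LOCAL-UNTWIST₂, existence half»: an independent short proof
of the verbatim `LocalUntwistExists` straight from ★★ `exists_absGal_fixing_smul_ltRoot_eq`. -/

section LocalUntwist

open ValuativeRel IsLocalRing Field
open Literature.NumberTheory.GaloisRepresentations Literature.NumberTheory.GaloisRepresentations.IsNonarchimedeanLocalField
  Literature.NumberTheory.GaloisRepresentations.LubinTate Literature.NumberTheory.PAdicHodge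

variable {F : Type} [Field F] [ValuativeRel F] [TopologicalSpace F] [IsNonarchimedeanLocalField F]

attribute [local instance] ltNormUniformSpace ltNormIsUniformAddGroup rk1 nF nE fintypeResidueField

variable {π : 𝒪[F]} (hπ : (valuation F).IsUniformizer (π : F))
variable (E : IntermediateField F (AlgebraicClosure F)) [FiniteDimensional F E] [Normal F E]

/-- VERBATIM k3-g40 (`ReadTwoCutK3G40.ActsAsFrobPow`): "`τ ∈ Aut_F(E·K_π^{m+1})` acts on `𝒪_E` as `φ^K`"
(`φ = frobUnitBall E σ₀`; `K` is NOT tied to the level). -/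
def ActsAsFrobPow (σ₀ : absoluteGaloisGroup F) (K : ℕ) {m : ℕ}
    (τ : (E ⊔ ltField π m : IntermediateField F (AlgebraicClosure F)) ≃ₐ[F]
      (E ⊔ ltField π m : IntermediateField F (AlgebraicClosure F))) : Prop :=
  ∀ x : unitBall E, τ (IntermediateField.inclusion le_sup_left (x : E)) =
    IntermediateField.inclusion le_sup_left
      (((((frobUnitBall E σ₀ : unitBall E ≃+* unitBall E) : unitBall E →+* unitBall E) :
        unitBall E → unitBall E)^[K] x : unitBall E) : E)

/-- VERBATIM k3-g40 (`ReadTwoCutK3G40.LocalUntwistExists`) = v7.4 **R217∃**: for every level `m`, Frobenius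
exponent `K` and unit `v ∈ 𝒪_F^×` there is `τ ∈ Aut_F(E·K_π^{m+1})` acting on `𝒪_E` as `φ^K` and moving
`ι ω_{m+1}` exactly as `σ_v = relGalOfUnit v` does. -/
def LocalUntwistExists (hE : E ≤ maxUnramified F) (σ₀ : absoluteGaloisGroup F) : Prop :=
  ∀ (m K : ℕ) (v : 𝒪[F]ˣ), ∃ τ : (E ⊔ ltField π m : IntermediateField F (AlgebraicClosure F)) ≃ₐ[F]
      (E ⊔ ltField π m : IntermediateField F (AlgebraicClosure F)),
    ActsAsFrobPow E σ₀ K τ ∧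
      mapPt τ (inclPt (le_sup_right : ltField π m ≤ E ⊔ ltField π m) (cohPt hπ m)) =
        mapPt (relGalOfUnit hπ E m hE v) (inclPt (le_sup_right : ltField π m ≤ E ⊔ ltField π m) (cohPt hπ m))

omit [ValuativeRel F] [TopologicalSpace F] [IsNonarchimedeanLocalField F] [FiniteDimensional F E] in
/-- H-A1 (dictionary line "φ^K = σ₀^K|_E"): powers of the restricted automorphism act as powers of `σ₀`. -/
theorem coe_restrictNormal_pow_apply (σ₀ : absoluteGaloisGroup F) (k : ℕ) (x : E) :
    (((((absoluteGaloisGroup.toAlgEquiv F σ₀).restrictNormal E) ^ k) x : E) : AlgebraicClosure F) =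
      (σ₀ ^ k) • ((x : E) : AlgebraicClosure F) := by
  induction k generalizing x with
  | zero => rw [pow_zero, pow_zero, AlgEquiv.one_apply, one_smul]
  | succ k ih => rw [pow_succ, AlgEquiv.mul_apply, ih, coe_restrictNormal_apply, pow_succ, mul_smul]

/-- H-A2: the `K`-fold iterate of `φ = frobUnitBall E σ₀` on `𝒪_E`, read in `F̄`, is `σ₀^K`. -/
theorem coe_frobUnitBall_iterate (σ₀ : absoluteGaloisGroup F) (K : ℕ) (x : unitBall E) :
    (((((((frobUnitBall E σ₀ : unitBall E ≃+* unitBall E) : unitBall E →+* unitBall E) :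
        unitBall E → unitBall E)^[K] x : unitBall E) : E) : AlgebraicClosure F)) =
      (σ₀ ^ K) • (((x : unitBall E) : E) : AlgebraicClosure F) := by
  rw [← RingHom.coe_pow, coe_frobUnitBall_pow_apply, coe_restrictNormal_pow_apply]

/-- H-A3 (dictionary line "σ' λ_{m+1} = [w] λ_{m+1} ⟹ χ_π(σ') ≡ w (mod π^{m+1})"): the Lubin–Tate character of an
element realising the unit `w` on `λ_{m+1}` is congruent to `w`. -/
theorem pow_dvd_lubinTateChar_sub_of_smul_ltRoot_eq (m : ℕ) (w : 𝒪[F]ˣ) {σ : absoluteGaloisGroup F}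
    (hσ : σ • ltRoot π m =
      (((ltAct hπ m (w : 𝒪[F]) (genPt hπ m) : unitBall (ltField π m)) : ltField π m) : AlgebraicClosure F)) :
    π ^ (m + 1) ∣ (lubinTateChar hπ σ : 𝒪[F]) - (w : 𝒪[F]) := by
  rw [← ltAct_genPt_eq_iff hπ]
  have h1 := (absGal_smul_ltRoot hπ σ m).symm.trans hσ
  apply Subtype.ext; apply Subtype.ext
  exact Subtype.val_injective h1

/-- ★ **R217∃ PROVED**: `LocalUntwistExists` holds for every `E ⊆ F^{nr}` finite normal and every `σ₀ ∈ Γ_F`.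
Witness: `τ := relRestrict (σ₀^K · σ')` with `σ' ∈ Gal(F̄/E)` realising `v · χ_π(σ₀)^{-K}` on `λ_{m+1}`
(`exists_absGal_fixing_smul_ltRoot_eq`, the tree's Galois form of `E ∩ K_π^{m+1} = F`). -/
theorem localUntwistExists (hE : E ≤ maxUnramified F) (σ₀ : absoluteGaloisGroup F) :
    LocalUntwistExists hπ E hE σ₀ := by
  intro m K v
  obtain ⟨σ', hσ'E, hσ'l⟩ :=
    exists_absGal_fixing_smul_ltRoot_eq hπ E hE m (v * ((lubinTateChar hπ σ₀) ^ K)⁻¹)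
  refine ⟨relRestrict hπ E m (σ₀ ^ K * σ'), fun x => ?_, ?_⟩
  · -- on `𝒪_E`: `σ'` fixes `E`, `σ₀^K` acts as `φ^K`
    apply Subtype.ext
    rw [coe_relRestrict_apply, IntermediateField.coe_inclusion, IntermediateField.coe_inclusion, mul_smul, hσ'E,
      coe_frobUnitBall_iterate]
  · -- on the torsion point: both sides are `[v · cohUnit] λ'`
    rw [cohPt_eq, inclPt_ltAct_genPt, mapPt_relRestrict_relAct, mapPt_relGalOfUnit_relAct, relAct_relGenPt_eq_iff,
      lubinTateChar_mul]
    have hK : lubinTateChar hπ (σ₀ ^ K) = (lubinTateChar hπ σ₀) ^ K := map_pow (lubinTateCharHom hπ) σ₀ K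
    rw [hK]
    obtain ⟨c, hc⟩ := pow_dvd_lubinTateChar_sub_of_smul_ltRoot_eq hπ m _ hσ'l
    have hunit : (((lubinTateChar hπ σ₀) ^ K : 𝒪[F]ˣ) : 𝒪[F]) *
        ((v * ((lubinTateChar hπ σ₀) ^ K)⁻¹ : 𝒪[F]ˣ) : 𝒪[F]) = (v : 𝒪[F]) := by
      rw [← Units.val_mul, mul_left_comm, mul_inv_cancel, mul_one]
    rw [Units.val_mul]
    exact ⟨(((lubinTateChar hπ σ₀) ^ K : 𝒪[F]ˣ) : 𝒪[F]) * (cohUnit hπ m : 𝒪[F]) * c, by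
      linear_combination ((((lubinTateChar hπ σ₀) ^ K : 𝒪[F]ˣ) : 𝒪[F]) * (cohUnit hπ m : 𝒪[F])) * hc +
        (cohUnit hπ m : 𝒪[F]) * hunit⟩

end LocalUntwist

/-! ## §B. R222 «SHIFT₂» — the torsion dictionary `ϑ(−2 − x) = −π' − ϑ(x)` in the `evS` currency, and the index
identity `ζ^{j(1+2^n)} = −ζ^j` for odd `j` (B72: the REFL shift is multiplication by `γ₀ = 1 + 2^n`) -/

section ShiftTwo

open ValuativeRel IsLocalRing Field IsNonarchimedeanLocalField
open Literature.NumberTheory.GaloisRepresentations Literature.NumberTheory.GaloisRepresentations.IsNonarchimedeanLocalField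
  Literature.NumberTheory.GaloisRepresentations.LubinTate Literature.NumberTheory.PAdicHodge

variable {F : Type} [Field F] [ValuativeRel F] [TopologicalSpace F] [IsNonarchimedeanLocalField F]
variable (hq : residueFieldCard F = 2) (h2 : (valuation F).IsUniformizer (((2 : ℕ) : 𝒪[F]) : F))
  {σ₀ : absoluteGaloisGroup F} (hσ₀ : IsAbsArithFrob σ₀) (u : 𝒪[F]ˣ)
  {ε : (maxUnramifiedCompletion F)ˣ}
  (hε : maxUnramifiedCompletion.galAut F σ₀ (ε : maxUnramifiedCompletion F) =
    algebraMap 𝒪[F] (maxUnramifiedCompletion F) (u : 𝒪[F]) * (ε : maxUnramifiedCompletion F))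

include hq in
/-- ★ **R222 «SHIFT₂» (k3-g40's H2 `compSeriesC_torsion_shift`) PROVED in the `evS` currency of R219-INST₂**:
for points `z, z'` of `𝔪_ℂ` with `1 + z' = −(1 + z)` (i.e. `z' = z [+]_{Ĝ_m} (−2)`),
`ϑ(z') = −π' − ϑ(z) = ϑ(z) [+]_{f'} ω₁'` with `ω₁' = −π' = ϑ(−2)` (`f' = π'X + X²`, `π' = 2u`;
`y [+]_{f'} (−π') = −π' − y`).  Dictionary: de Shalit I.3.3 (7)–(7′) `θ(ς(1+S) − 1) = θ(S) [+] ω`, `ς = −1`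
↦ tree ★★ `coe_evalPt₁_compSeriesC_reflect` + `evalPt₁_compSeriesC_eq_mk_evS`. -/
theorem evS_compSeriesC_shift (z z' : (maxNilIdealC F).toIdeal)
    (hz' : ((z' : CBall F) : CompletedAlgClosure F) = -2 - ((z : CBall F) : CompletedAlgClosure F)) :
    ((evS (maxNilIdealC F) z' ((compSeriesC h2 hσ₀ u hε).map (algebraMap (UnrCoeff F) (CBall F))) : CBall F) :
        CompletedAlgClosure F) =
      -algebraMap F (CompletedAlgClosure F) ((((u : 𝒪[F]) * ((2 : ℕ) : 𝒪[F]) : 𝒪[F]) : F)) -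
        ((evS (maxNilIdealC F) z ((compSeriesC h2 hσ₀ u hε).map (algebraMap (UnrCoeff F) (CBall F))) : CBall F) :
          CompletedAlgClosure F) := by
  have h := coe_evalPt₁_compSeriesC_reflect hq h2 hσ₀ u hε z z' hz'
  rw [evalPt₁_compSeriesC_eq_mk_evS hσ₀ u hε h2 z', evalPt₁_compSeriesC_eq_mk_evS hσ₀ u hε h2 z] at h
  exact h

include hq in
/-- R222, point form with the torsion point NAMED: for the point `t = −2` of `𝔪_ℂ` (`ϑ(t) = −π' = ω₁'`, tree
`coe_evalPt₁_compSeriesC_negTwo`), `ϑ(z') = ϑ(t) − ϑ(z)` whenever `z' = −2 − z`. -/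
theorem evS_compSeriesC_shift_negTwo (t z z' : (maxNilIdealC F).toIdeal)
    (ht : ((t : CBall F) : CompletedAlgClosure F) = -2)
    (hz' : ((z' : CBall F) : CompletedAlgClosure F) = -2 - ((z : CBall F) : CompletedAlgClosure F)) :
    ((evS (maxNilIdealC F) z' ((compSeriesC h2 hσ₀ u hε).map (algebraMap (UnrCoeff F) (CBall F))) : CBall F) :
        CompletedAlgClosure F) =
      ((evS (maxNilIdealC F) t ((compSeriesC h2 hσ₀ u hε).map (algebraMap (UnrCoeff F) (CBall F))) : CBall F) :
          CompletedAlgClosure F) -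
        ((evS (maxNilIdealC F) z ((compSeriesC h2 hσ₀ u hε).map (algebraMap (UnrCoeff F) (CBall F))) : CBall F) :
          CompletedAlgClosure F) := by
  have ht' := coe_evalPt₁_compSeriesC_negTwo hq h2 hσ₀ u hε t ht
  rw [evalPt₁_compSeriesC_eq_mk_evS hσ₀ u hε h2 t] at ht'
  rw [evS_compSeriesC_shift hq h2 hσ₀ u hε z z' hz']
  change _ = ((evS (maxNilIdealC F) t ((compSeriesC h2 hσ₀ u hε).map (algebraMap (UnrCoeff F) (CBall F))) :
    CBall F) : CompletedAlgClosure F) - _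
  rw [show ((evS (maxNilIdealC F) t ((compSeriesC h2 hσ₀ u hε).map (algebraMap (UnrCoeff F) (CBall F))) :
    CBall F) : CompletedAlgClosure F) = -algebraMap F (CompletedAlgClosure F)
      ((((u : 𝒪[F]) * ((2 : ℕ) : 𝒪[F]) : 𝒪[F]) : F)) from ht']

end ShiftTwo

section IndexShift

/-- ★ B72 in kernel, general `n`: for `ζ` of exact order `2^{n+1}` in a domain and `j` odd,
`ζ^{j(1+2^n)} = −ζ^j` — the REFL shift `j ↦ j·γ₀`, `γ₀ = 1 + 2^n`, is `ζ^j ↦ −ζ^j`, i.e. `1 + z ↦ −(1 + z)` on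
`z_j = ζ^j − 1`. -/
theorem pow_mul_one_add_two_pow_eq_neg {R : Type*} [CommRing R] [IsDomain R] {n : ℕ} {ζ : R}
    (hζ : IsPrimitiveRoot ζ (2 ^ (n + 1))) {j : ℕ} (hj : Odd j) :
    ζ ^ (j * (1 + 2 ^ n)) = -ζ ^ j := by
  have h1 : ζ ^ 2 ^ n = -1 :=
    (hζ.pow (by positivity) (show 2 ^ (n + 1) = 2 ^ n * 2 by rw [pow_succ])).eq_neg_one_of_two_right
  rw [mul_add, mul_one, pow_add, pow_mul', h1, hj.neg_one_pow]
  ring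

/-- Hence the torsion points `z_j := ζ^j − 1` satisfy the hypothesis of `evS_compSeriesC_shift`:
`z_{jγ₀} = −2 − z_j`. -/
theorem torsionPt_index_shift {R : Type*} [CommRing R] [IsDomain R] {n : ℕ} {ζ : R}
    (hζ : IsPrimitiveRoot ζ (2 ^ (n + 1))) {j : ℕ} (hj : Odd j) :
    ζ ^ (j * (1 + 2 ^ n)) - 1 = -2 - (ζ ^ j - 1) := by
  rw [pow_mul_one_add_two_pow_eq_neg hζ hj]; ring

/-- `γ₀ = 1 + 2^n` is an involution of `ℤ/2^{n+1}` for `n ≥ 1` (`(1+2^n)² = 1 + 2^{n+1} + 2^{2n}`). -/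
theorem one_add_two_pow_sq {n : ℕ} (hn : 1 ≤ n) : ((1 + 2 ^ n : ZMod (2 ^ (n + 1)))) ^ 2 = 1 := by
  have h : ((2 ^ (n + 1) : ℕ) : ZMod (2 ^ (n + 1))) = 0 := ZMod.natCast_self _
  obtain ⟨k, rfl⟩ : ∃ k, n = k + 1 := ⟨n - 1, by omega⟩
  have e : ((1 + 2 ^ (k + 1) : ZMod (2 ^ (k + 1 + 1)))) ^ 2 =
      1 + ((2 ^ (k + 1 + 1) : ℕ) : ZMod (2 ^ (k + 1 + 1))) * (1 + 2 ^ k) := by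
    push_cast; ring
  rw [e, h, zero_mul, add_zero]

end IndexShift

/-! ## §C. R219-INST₂ leaf «γ₀-CHARACTER» (B72, character half, GENERAL `n`): a Dirichlet character modulo
`2^{n+1}` that does not factor through `2^n` takes the value `−1` at `γ₀ = 1 + 2^n` — Mathlib match
(`DirichletCharacter.factorsThrough_iff_ker_unitsMap` + `#ker = 2` by `ZMod.card_units_eq_totient`). The critic's
certificate `critic_k3g40_K3_reflsum.lean` decided `N = 4, 8`; this is the all-`n` kernel lemma. -/

section GammaZeroChar

/-- `#ker((ℤ/2^{n+1})ˣ → (ℤ/2^n)ˣ) = 2` for `n ≥ 1` (index of a surjection, `φ(2^{n+1}) = 2·φ(2^n)`; pattern of the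
tree's private `CyclotomicFermatCMTypes….card_ker_unitsMap`, here at the prime `2`). -/
theorem card_ker_unitsMap_two_pow {n : ℕ} (hn : 1 ≤ n) :
    Nat.card (ZMod.unitsMap (pow_dvd_pow 2 (Nat.le_succ n))).ker = 2 := by
  set f := ZMod.unitsMap (pow_dvd_pow 2 (Nat.le_succ n)) with hf
  have hsurj : Function.Surjective f := ZMod.unitsMap_surjective _
  have h1 : f.ker.index = Nat.card (ZMod (2 ^ n))ˣ := by
    rw [Subgroup.index_ker, MonoidHom.range_eq_top_of_surjective f hsurj, Subgroup.card_top]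
  have h2 := f.ker.card_mul_index
  rw [h1, Nat.card_eq_fintype_card (α := (ZMod (2 ^ n))ˣ),
    Nat.card_eq_fintype_card (α := (ZMod (2 ^ (n + 1)))ˣ), ZMod.card_units_eq_totient,
    ZMod.card_units_eq_totient, Nat.totient_prime_pow Nat.prime_two hn,
    Nat.totient_prime_pow Nat.prime_two (by omega)] at h2
  have hpos : 0 < 2 ^ (n - 1) * (2 - 1) := by positivity
  have h3 : 2 ^ (n + 1 - 1) * (2 - 1) = 2 * (2 ^ (n - 1) * (2 - 1)) := by
    rw [← mul_assoc, ← pow_succ']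
    congr 2
    omega
  rw [h3] at h2
  exact Nat.eq_of_mul_eq_mul_right hpos h2

/-- `γ₀ = 1 + 2^n` as a unit of `ℤ/2^{n+1}` (`γ₀² = 1`, `one_add_two_pow_sq`). -/
def gammaZero {n : ℕ} (hn : 1 ≤ n) : (ZMod (2 ^ (n + 1)))ˣ :=
  Units.mkOfMulEqOne (1 + 2 ^ n) (1 + 2 ^ n) (by rw [← sq]; exact one_add_two_pow_sq hn)

@[simp] theorem val_gammaZero {n : ℕ} (hn : 1 ≤ n) :
    ((gammaZero hn : (ZMod (2 ^ (n + 1)))ˣ) : ZMod (2 ^ (n + 1))) = 1 + 2 ^ n :=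
  Units.val_mkOfMulEqOne _

/-- `γ₀` lies in the kernel of the reduction `(ℤ/2^{n+1})ˣ → (ℤ/2^n)ˣ`. -/
theorem gammaZero_mem_ker {n : ℕ} (hn : 1 ≤ n) :
    gammaZero hn ∈ (ZMod.unitsMap (pow_dvd_pow 2 (Nat.le_succ n))).ker := by
  have h0 : (2 : ZMod (2 ^ n)) ^ n = 0 := by exact_mod_cast ZMod.natCast_self (2 ^ n)
  rw [MonoidHom.mem_ker, Units.ext_iff, ZMod.unitsMap_def, Units.coe_map, val_gammaZero, Units.val_one,
    MonoidHom.coe_coe, map_add, map_one, map_pow, map_ofNat, h0, add_zero]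

/-- `γ₀ ≠ 1` (`2^n ≢ 0 (mod 2^{n+1})`). -/
theorem gammaZero_ne_one {n : ℕ} (hn : 1 ≤ n) : gammaZero hn ≠ 1 := by
  intro h
  have h' := congrArg (fun u : (ZMod (2 ^ (n + 1)))ˣ => (u : ZMod (2 ^ (n + 1)))) h
  simp only [val_gammaZero, Units.val_one, add_eq_left] at h'
  have h2n : ((2 ^ n : ℕ) : ZMod (2 ^ (n + 1))) ≠ 0 := by
    rw [Ne, ZMod.natCast_eq_zero_iff]
    intro hd
    have := Nat.le_of_dvd (by positivity) hd
    have : 2 ^ n < 2 ^ (n + 1) := Nat.pow_lt_pow_right (by norm_num) (by omega)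
    omega
  exact h2n (by exact_mod_cast h')

/-- The kernel is exactly `{1, γ₀}`. -/
theorem mem_ker_unitsMap_iff {n : ℕ} (hn : 1 ≤ n) (t : (ZMod (2 ^ (n + 1)))ˣ) :
    t ∈ (ZMod.unitsMap (pow_dvd_pow 2 (Nat.le_succ n))).ker ↔ t = 1 ∨ t = gammaZero hn := by
  classical
  constructor
  · intro ht
    by_contra hne
    rw [not_or] at hne
    -- three distinct elements `1, γ₀, t` in a group of order `2`
    have hcard := card_ker_unitsMap_two_pow hn
    set K := (ZMod.unitsMap (pow_dvd_pow 2 (Nat.le_succ n))).ker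
    haveI : Fintype K := Fintype.ofFinite K
    have h3 : ({⟨1, K.one_mem⟩, ⟨gammaZero hn, gammaZero_mem_ker hn⟩, ⟨t, ht⟩} : Finset K).card ≤
        Fintype.card K := Finset.card_le_univ _
    rw [← Nat.card_eq_fintype_card, hcard] at h3
    rw [Finset.card_insert_of_notMem, Finset.card_insert_of_notMem, Finset.card_singleton] at h3
    · omega
    · simp only [Finset.mem_singleton, Subtype.mk.injEq]; exact fun h => hne.2 h.symm
    · simp only [Finset.mem_insert, Finset.mem_singleton, Subtype.mk.injEq]
      rintro (h | h)
      · exact gammaZero_ne_one hn h.symm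
      · exact hne.1 h.symm
  · rintro (rfl | rfl)
    · exact (ZMod.unitsMap _).ker.one_mem
    · exact gammaZero_mem_ker hn

/-- ★ **B72 in kernel, general `n` (character half):** a character of `(ℤ/2^{n+1})` (values in any domain) that does
NOT factor through `2^n` — e.g. one of conductor exactly `2^{n+1}` — is `−1` at `γ₀ = 1 + 2^n`.  (`n = 1`: `χ₄(3) = −1`;
`n = 2`: `χ₈(5) = χ₈'(5) = −1`; the critic's `decide`d instances are `n = 1, 2`.) -/
theorem apply_one_add_two_pow_eq_neg_one {R : Type*} [CommRing R] [IsDomain R] {n : ℕ} (hn : 1 ≤ n)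
    (χ : DirichletCharacter R (2 ^ (n + 1))) (hχ : ¬χ.FactorsThrough (2 ^ n)) :
    χ (1 + 2 ^ n) = -1 := by
  classical
  have hdvd : 2 ^ n ∣ 2 ^ (n + 1) := pow_dvd_pow 2 (Nat.le_succ n)
  rw [DirichletCharacter.factorsThrough_iff_ker_unitsMap hdvd, SetLike.not_le_iff_exists] at hχ
  obtain ⟨t, htK, htχ⟩ := hχ
  rcases (mem_ker_unitsMap_iff hn t).mp htK with rfl | rfl
  · exact absurd (MonoidHom.ker _).one_mem htχ
  · -- `χ(γ₀) ≠ 1` and `χ(γ₀)² = χ(γ₀²) = 1`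
    have hne : χ (1 + 2 ^ n) ≠ 1 := by
      intro h1
      apply htχ
      rw [MonoidHom.mem_ker]
      ext
      rw [MulChar.coe_toUnitHom, val_gammaZero, Units.val_one, h1]
    have hsq : χ (1 + 2 ^ n) * χ (1 + 2 ^ n) = 1 := by
      rw [← map_mul, ← sq, one_add_two_pow_sq hn, map_one]
    rcases mul_self_eq_one_iff.mp hsq with h | h
    · exact absurd h hne
    · exact h

/-- `γ₀ · γ₀ = 1` (hypothesis `hγ₀` of the critic's `refl_table_charSum` / `hu` of `mulChar_eq_neg_one_of_sq`). -/
theorem gammaZero_mul_self {n : ℕ} (hn : 1 ≤ n) : gammaZero hn * gammaZero hn = 1 :=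
  Units.ext (by rw [Units.val_mul, val_gammaZero, Units.val_one, ← sq]; exact one_add_two_pow_sq hn)

/-- ★ JUNCTION WITH THE CRITIC'S B72 CERTIFICATE (`critic_k3g40_K3_reflsum.lean`, hypothesis `hψ : ψ (e γ₀) = −1`,
there `decide`d only for `N = 4, 8`): for every `n ≥ 1` and every character of level `2^{n+1}` NOT factoring
through `2^n`, `χ(γ₀) = −1` in the certificate's `Units`-currency. -/
theorem apply_gammaZero_eq_neg_one {R : Type*} [CommRing R] [IsDomain R] {n : ℕ} (hn : 1 ≤ n)
    (χ : DirichletCharacter R (2 ^ (n + 1))) (hχ : ¬χ.FactorsThrough (2 ^ n)) :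
    χ ((gammaZero hn : (ZMod (2 ^ (n + 1)))ˣ) : ZMod (2 ^ (n + 1))) = -1 := by
  rw [val_gammaZero]; exact apply_one_add_two_pow_eq_neg_one hn χ hχ

/-- ★ …and conversely (away from characteristic 2 of the VALUE ring): `χ(1 + 2^n) = −1` iff `χ` does not factor
through `2^n` — so "exact conductor `2^{n+1}`" and "`χ(γ₀) = −1`" are the same condition on level-`2^{n+1}`
characters. -/
theorem not_factorsThrough_iff_apply_eq_neg_one {R : Type*} [CommRing R] [IsDomain R] {n : ℕ} (hn : 1 ≤ n)
    (χ : DirichletCharacter R (2 ^ (n + 1))) (h2 : (2 : R) ≠ 0) :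
    ¬χ.FactorsThrough (2 ^ n) ↔ χ (1 + 2 ^ n) = -1 := by
  refine ⟨apply_one_add_two_pow_eq_neg_one hn χ, fun hval hft => ?_⟩
  have hmem := (DirichletCharacter.factorsThrough_iff_ker_unitsMap (pow_dvd_pow 2 (Nat.le_succ n))).mp hft
    (gammaZero_mem_ker hn)
  rw [MonoidHom.mem_ker, Units.ext_iff, MulChar.coe_toUnitHom, val_gammaZero, Units.val_one, hval] at hmem
  apply h2
  calc (2 : R) = 1 - (-1) := by norm_num
    _ = 0 := by rw [hmem, sub_self]

/-- VERBATIM the critic's `CriticG41.refl_table_charSum` (B72 certificate, crux commit 289ad55008c9) — copied, not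
claimed, so that the instantiation below is kernel-checked in one file. -/
theorem refl_table_charSum {R' : Type*} [CommRing R'] {N : ℕ} [NeZero N] {Γ : Type*} [Group Γ] [Fintype Γ]
    (e : Γ ≃* (ZMod N)ˣ) (ψ : MulChar (ZMod N) R') (T : Γ → R') (κ : R') (γ₀ : Γ)
    (hγ₀ : γ₀ * γ₀ = 1) (hψ : ψ ((e γ₀ : (ZMod N)ˣ) : ZMod N) = -1) :
    ∑ γ : Γ, ψ ((e γ : (ZMod N)ˣ) : ZMod N) * (κ * (T γ - T (γ * γ₀))) =
      2 * κ * ∑ γ : Γ, ψ ((e γ : (ZMod N)ˣ) : ZMod N) * T γ := by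
  have hre : ∑ γ : Γ, ψ ((e γ : (ZMod N)ˣ) : ZMod N) * T (γ * γ₀) =
      ∑ δ : Γ, ψ ((e (δ * γ₀) : (ZMod N)ˣ) : ZMod N) * T δ := by
    refine (Fintype.sum_equiv (Equiv.mulRight γ₀)
      (fun δ => ψ ((e (δ * γ₀) : (ZMod N)ˣ) : ZMod N) * T δ)
      (fun γ => ψ ((e γ : (ZMod N)ˣ) : ZMod N) * T (γ * γ₀)) (fun δ => ?_)).symm
    simp only [Equiv.coe_mulRight, mul_assoc, hγ₀, mul_one]
  have hneg : ∀ δ : Γ, ψ ((e (δ * γ₀) : (ZMod N)ˣ) : ZMod N) = -ψ ((e δ : (ZMod N)ˣ) : ZMod N) := by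
    intro δ
    rw [map_mul, Units.val_mul, map_mul, hψ, mul_neg, mul_one]
  have hsplit : ∀ γ : Γ, ψ ((e γ : (ZMod N)ˣ) : ZMod N) * (κ * (T γ - T (γ * γ₀))) =
      κ * (ψ ((e γ : (ZMod N)ˣ) : ZMod N) * T γ) - κ * (ψ ((e γ : (ZMod N)ˣ) : ZMod N) * T (γ * γ₀)) := by
    intro γ; ring
  simp_rw [hsplit]
  rw [Finset.sum_sub_distrib, ← Finset.mul_sum, ← Finset.mul_sum, hre]
  simp_rw [hneg, neg_mul, Finset.sum_neg_distrib]
  ring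

/-- ★ **R219-INST₂'s «ONE application with `Γ := (ℤ/N)ˣ`», character bookkeeping discharged for ALL `n ≥ 1`:**
for `N = 2^{n+1}` and ANY table `T` on `(ℤ/N)ˣ`, the REFL-table character sum against a character not factoring
through `2^n` is `2κ·` the plain one — the critic's `refl_table_charSum` with `e := refl`, `γ₀ := 1 + 2^n`, both of
its hypotheses (`hγ₀`, `hψ`) now THEOREMS (`gammaZero_mul_self`, `apply_gammaZero_eq_neg_one`).  What remains
witness-specific in R219-INST₂ is only the table `T` itself (`∘ϑ` line, `V = L_b + const`, SEAM on units). -/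
theorem refl_table_charSum_two_pow {R : Type*} [CommRing R] [IsDomain R] {n : ℕ} (hn : 1 ≤ n)
    (χ : DirichletCharacter R (2 ^ (n + 1))) (hχ : ¬χ.FactorsThrough (2 ^ n))
    (T : (ZMod (2 ^ (n + 1)))ˣ → R) (κ : R) :
    ∑ γ : (ZMod (2 ^ (n + 1)))ˣ, χ (γ : ZMod (2 ^ (n + 1))) * (κ * (T γ - T (γ * gammaZero hn))) =
      2 * κ * ∑ γ : (ZMod (2 ^ (n + 1)))ˣ, χ (γ : ZMod (2 ^ (n + 1))) * T γ :=
  refl_table_charSum (MulEquiv.refl _) χ T κ (gammaZero hn) (gammaZero_mul_self hn)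
    (apply_gammaZero_eq_neg_one hn χ hχ)

end GammaZeroChar

/-! ## §D. R219-INST₂ leaf «H3 Λ₂-LIFT» in residue characteristic 2: the coefficients `(−1)^d 2^d/(d+1)` of
`Λ₂ = ½·log(1+2X)` lie in `𝒪_{ℂ_F}` — so the integral series `L ∈ 𝒪_ℂ⟦X⟧` that k3-g40's `read_value_eq_tsum_lamTerm`
takes as hypotheses (`hL0`, `hL`) EXISTS.  Mathlib match: `Nat.exists_eq_two_pow_mul_odd` + the isosceles triangle
`IsUltrametricDist.norm_add_eq_max_of_norm_ne_norm` + `Nat.lt_two_pow_self` (`v₂(d+1) ≤ d`).  Classical dictionary: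
`p^{d}/(d+1) ∈ ℤ_p` (Koblitz GTM 58 IV.1; Washington GTM 83 §5.1), here for ANY ultrametric field with `‖2‖ < 1`. -/

section LamTwoLift

/-- Odd naturals are units in norm: `‖m‖ = 1` for `m` odd, in any ultrametric normed field with `‖2‖ < 1`. -/
theorem norm_natCast_eq_one_of_odd {L : Type*} [NormedField L] [IsUltrametricDist L] (h2 : ‖(2 : L)‖ < 1)
    {m : ℕ} (hm : Odd m) : ‖(m : L)‖ = 1 := by
  obtain ⟨k, rfl⟩ := hm
  have hk : ‖(2 * k : L)‖ < 1 := by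
    rw [norm_mul]
    calc ‖(2 : L)‖ * ‖(k : L)‖ ≤ ‖(2 : L)‖ * 1 := by
          gcongr
          exact IsUltrametricDist.norm_natCast_le_one L k
      _ < 1 := by rw [mul_one]; exact h2
  have hne : ‖(2 * k : L)‖ ≠ ‖(1 : L)‖ := by rw [norm_one]; exact hk.ne
  rw [Nat.cast_add, Nat.cast_mul, Nat.cast_two, Nat.cast_one,
    IsUltrametricDist.norm_add_eq_max_of_norm_ne_norm hne, norm_one, max_eq_right hk.le]

/-- ★ `‖2^d/(d+1)‖ ≤ 1` (`d+1 = 2^v·m`, `m` odd, `2^v ≤ d+1 ≤ 2^d`). -/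
theorem norm_two_pow_div_le_one {L : Type*} [NormedField L] [IsUltrametricDist L] (h2 : ‖(2 : L)‖ < 1)
    (d : ℕ) : ‖(2 : L) ^ d / ((d : L) + 1)‖ ≤ 1 := by
  obtain ⟨v, m, hm, hvm⟩ := Nat.exists_eq_two_pow_mul_odd (Nat.succ_ne_zero d)
  have hd1 : ((d : L) + 1) = (2 : L) ^ v * (m : L) := by
    have h := congrArg (Nat.cast : ℕ → L) hvm
    push_cast at h
    exact h
  have hv : v ≤ d := by
    have h1 : 2 ^ v ≤ d + 1 := by
      calc 2 ^ v ≤ 2 ^ v * m := Nat.le_mul_of_pos_right _ hm.pos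
        _ = d + 1 := hvm.symm
    exact (Nat.pow_le_pow_iff_right (by norm_num)).mp (h1.trans Nat.lt_two_pow_self)
  rw [norm_div, hd1, norm_mul, norm_natCast_eq_one_of_odd h2 hm, mul_one, norm_pow, norm_pow]
  exact div_le_one_of_le₀ (pow_le_pow_of_le_one (norm_nonneg _) h2.le hv) (by positivity)

open Literature.NumberTheory.GaloisRepresentations Literature.NumberTheory.GaloisRepresentations.IsNonarchimedeanLocalField
  Literature.NumberTheory.GaloisRepresentations.LubinTate Literature.NumberTheory.PAdicHodge

variable {F : Type} [Field F] [ValuativeRel F] [TopologicalSpace F] [IsNonarchimedeanLocalField F]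

/-- The `Λ₂`-coefficient `(−1)^d 2^d/(d+1)` as an element of `𝒪_{ℂ_F}`. -/
def lamCoeff (h2 : ‖(2 : CompletedAlgClosure F)‖ < 1) (d : ℕ) : CBall F :=
  ⟨(-1) ^ d * (2 : CompletedAlgClosure F) ^ d / ((d : CompletedAlgClosure F) + 1),
    (mem_unitBall_iff _).mpr (by
      rw [mul_div_assoc, norm_mul, norm_pow, norm_neg, norm_one, one_pow, one_mul]
      exact norm_two_pow_div_le_one h2 d)⟩

/-- The integral lift `L = Σ_{d≥0} (−1)^d 2^d/(d+1) · X^{d+1} ∈ 𝒪_{ℂ_F}⟦X⟧` of `Λ₂ = ½ log(1 + 2X)`. -/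
def Lam2C (h2 : ‖(2 : CompletedAlgClosure F)‖ < 1) : PowerSeries (CBall F) :=
  PowerSeries.mk fun n => if n = 0 then 0 else lamCoeff h2 (n - 1)

theorem coeff_zero_Lam2C (h2 : ‖(2 : CompletedAlgClosure F)‖ < 1) : PowerSeries.coeff 0 (Lam2C h2) = 0 := by
  rw [Lam2C, PowerSeries.coeff_mk, if_pos rfl]

theorem coeff_succ_Lam2C (h2 : ‖(2 : CompletedAlgClosure F)‖ < 1) (d : ℕ) :
    ((PowerSeries.coeff (d + 1) (Lam2C h2) : CBall F) : CompletedAlgClosure F) =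
      (-1) ^ d * (2 : CompletedAlgClosure F) ^ d / ((d : CompletedAlgClosure F) + 1) := by
  rw [Lam2C, PowerSeries.coeff_mk, if_neg (Nat.succ_ne_zero d), Nat.add_sub_cancel]
  rfl

/-- ★ **H3 «Λ₂-LIFT» (k3-g40 P3) PROVED**: in residue characteristic `2` (`‖2‖_{ℂ_F} < 1`, tree `norm_two_lt_one_C h2`)
there is `L ∈ 𝒪_{ℂ_F}⟦X⟧` with `L(0) = 0` and `[X^{d+1}]L = (−1)^d 2^d/(d+1)`. -/
theorem exists_Lam2_lift (h2 : ‖(2 : CompletedAlgClosure F)‖ < 1) :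
    ∃ L : PowerSeries (CBall F), ((PowerSeries.coeff 0 L : CBall F) : CompletedAlgClosure F) = 0 ∧
      ∀ d : ℕ, ((PowerSeries.coeff (d + 1) L : CBall F) : CompletedAlgClosure F) =
        (-1) ^ d * (2 : CompletedAlgClosure F) ^ d / ((d : CompletedAlgClosure F) + 1) :=
  ⟨Lam2C h2, by rw [coeff_zero_Lam2C]; rfl, coeff_succ_Lam2C h2⟩

/-- ★ The same in the EXACT hypothesis shape of k3-g40's `read_value_eq_tsum_lamTerm` (`hL0`, `hL`), for any ring
map `θ : ℂ_F → M` into a field (there `M = ℂ_[2]`). -/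
theorem exists_Lam2_lift_map (h2 : ‖(2 : CompletedAlgClosure F)‖ < 1) {M : Type*} [Field M]
    (θ : CompletedAlgClosure F →+* M) :
    ∃ L : PowerSeries (CBall F), θ ((PowerSeries.coeff 0 L : CBall F) : CompletedAlgClosure F) = 0 ∧
      ∀ d : ℕ, θ ((PowerSeries.coeff (d + 1) L : CBall F) : CompletedAlgClosure F) =
        (-1) ^ d * (2 : M) ^ d / ((d : M) + 1) := by
  refine ⟨Lam2C h2, ?_, fun d => ?_⟩
  · rw [coeff_zero_Lam2C]; exact map_zero θ
  · rw [coeff_succ_Lam2C, map_div₀, map_mul, map_pow, map_pow, map_neg, map_one, map_add, map_natCast, map_one,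
      map_ofNat]

/-- ★ Coefficientwise form matching k3-g40's `coeff_Lam2` (`Lam2 A := mk fun n ↦ if n = 0 then 0 else
algebraMap ℚ A ((−1)^{n+1} 2^{n−1}/n)`): under any ring map `θ` into a characteristic-0 field `M`,
`θ(L) = Lam2 M` coefficient by coefficient — i.e. `(Lam2C).map (θ ∘ subtype) = Lam2 M`. -/
theorem map_coeff_Lam2C (h2 : ‖(2 : CompletedAlgClosure F)‖ < 1) {M : Type*} [Field M] [CharZero M]
    (θ : CompletedAlgClosure F →+* M) (n : ℕ) :
    θ ((PowerSeries.coeff n (Lam2C h2) : CBall F) : CompletedAlgClosure F) =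
      if n = 0 then 0 else algebraMap ℚ M ((-1 : ℚ) ^ (n + 1) * 2 ^ (n - 1) / n) := by
  cases n with
  | zero => rw [if_pos rfl, coeff_zero_Lam2C]; exact map_zero θ
  | succ d =>
    rw [if_neg (Nat.succ_ne_zero d), coeff_succ_Lam2C, map_div₀, map_mul, map_pow, map_pow, map_neg, map_one,
      map_add, map_natCast, map_one, map_ofNat, Nat.add_sub_cancel, eq_ratCast]
    push_cast
    ring

end LamTwoLift

/-! ## §E. R219-INST₂ leaf «H1 HALF-LIFT»: a power series `P ≡ 1 (mod 2)` coefficientwise with `P(0) = 1` is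
`1 + 2·y` with `y(0) = 0` (coefficientwise choice) — pure algebra over any commutative ring and any modulus `a`. -/

section HalfLift

theorem exists_eq_one_add_C_mul {A : Type*} [CommRing A] (a : A) (P : PowerSeries A)
    (hP0 : PowerSeries.constantCoeff P = 1) (hP : ∀ n : ℕ, a ∣ PowerSeries.coeff (n + 1) P) :
    ∃ y : PowerSeries A, PowerSeries.constantCoeff y = 0 ∧ P = 1 + PowerSeries.C a * y := by
  classical
  choose c hc using hP
  refine ⟨PowerSeries.mk fun n => if n = 0 then 0 else c (n - 1), ?_, ?_⟩
  · rw [← PowerSeries.coeff_zero_eq_constantCoeff_apply, PowerSeries.coeff_mk, if_pos rfl]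
  · ext n
    rw [map_add, PowerSeries.coeff_one, PowerSeries.coeff_C_mul, PowerSeries.coeff_mk]
    cases n with
    | zero => rw [if_pos rfl, if_pos rfl, mul_zero, add_zero, PowerSeries.coeff_zero_eq_constantCoeff_apply, hP0]
    | succ k => rw [if_neg (Nat.succ_ne_zero k), if_neg (Nat.succ_ne_zero k), zero_add, Nat.add_sub_cancel, hc k]

end HalfLift

/-! ## §F. Degenerate-instance checks (B68): the dictionary is not vacuous -/

section Checks

/-- `n = 1`: `ζ = i` (order 4), `j = 1`: `i^{1·3} = i³ = −i` ✓ (`γ₀ = 3 ≡ −1 (mod 4)` only at `n = 1`). -/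
example : (3 : ZMod 4) = -1 := by decide

/-- `n = 2`: `γ₀ = 5 ≠ −1 = 7 (mod 8)` — B72: the shift is NOT `−1` for `n ≥ 2`. -/
example : (5 : ZMod 8) ≠ -1 := by decide

/-- `(1 + 2^n)² = 1` at `n = 2`: `25 ≡ 1 (mod 8)`. -/
example : ((1 + 2 ^ 2 : ZMod (2 ^ 3))) ^ 2 = 1 := one_add_two_pow_sq (by norm_num)

/-- `γ₀ = 5` reduces to `1` in `ℤ/4` and is not `1` in `ℤ/8` (the two halves of `mem_ker_unitsMap_iff` at `n = 2`). -/
example : ((5 : ZMod 8) : ZMod 8).val % 4 = 1 ∧ (5 : ZMod 8) ≠ 1 := by decide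

/-- `v₂(d+1) ≤ d`: the first cases of the `Λ₂`-integrality (`d = 1`: `2/2`; `d = 3`: `8/4`; `d = 7`: `128/8`). -/
example : (2 : ℚ) ^ 1 / 2 = 1 ∧ (2 : ℚ) ^ 3 / 4 = 2 ∧ (2 : ℚ) ^ 7 / 8 = 16 := by norm_num

end Checks

end Summit.BirchSwinnertonDyer.BirchSwinnertonDyer.Cruxes.SplitBadTwoLowerHalfOfFacts.DisjointShiftK2G41
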